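/-
Copyright (c) 2026 The HCML crux team. All rights reserved.
Released under Apache 2.0 license as described in the file LICENSE.
Authors: K2E3-p23 (g5) (explicit-unit `hodgecm-mathlib-K2E3-p23-g5`)
-/
import Summits.HodgeConjecture.HodgeConjecture.Theorems.K2E3GL3ModCocompactEllPackage            -- ★ (B3) p857818 (this seat): `exists_ellWeight_quotScalar`; brings ★ B1, B0a, B0a-U
import Summits.HodgeConjecture.HodgeConjecture.Theorems.K2E3SupercuspidalCharacterDominatedLimit  -- ★ p856074 (K2E3-p20): HC 1970 Thm 16 assembly (generic `G`)
import Summits.HodgeConjecture.HodgeConjecture.Theorems.F0P3bSupercuspidalUnitarizable            -- ★ `Representation.isUnitarizable_of_isSupercuspidal_of_isCompact_center`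
import Literature.NumberTheory.Automorphic.MatrixCoefficientsSupercuspidalAdmissibleProofs        -- ★ `Representation.IsSupercuspidal.isAdmissible_of_sigmaCompactSpace`
import Literature.NumberTheory.Automorphic.AdmissibleInvariantFormSchur                           -- ★ `IsSupercuspidal.hasCompactSupport_sesqForm_apply_apply`, `continuous_sesqForm_apply_apply`
import HarnessLib

/-!
# (GL-[M6]-sc, B6-core) Harish-Chandra's Theorem 16 on `G_Λ = GL₃(F) ⧸ Λ·1`: the character of a supercuspidal class is an `L¹_loc` FUNCTION,
# modulo the NON-ELLIPTIC estimates only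

Cell `hodgecm-mathlib`, Track B, line `K2_E3_EllipticInputs`; payer «GL-[M6]-sc» of leaf (11-3-split-sc) (dealer K2E3-plan (g3) D63, line lead K2E3-p23
(g4 → g5), MEMO «M6sc-ROAD v2» brick B6-core).  The composition at `G_Λ` of ★ p856074 (Harish-Chandra 1970 Thm 16, generic) with the ELLIPTIC package ★ B3:
for a supercuspidal class `c` of `G_Λ` with representative `r`, invariant positive-definite Hermitian `B`, `v₁ ≠ 0`, a compact exhaustion `Ω` and the truncated
orbital integrals `Θₙ(g) := ∫_{Ω n} B v₁ (r(xgx⁻¹) v₁) dμ` of the coefficient, IF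

  **(lim∖ell)** `Θₙ(g) → F(g)` for a.e. `g` with NON-compact centraliser, and
  **(dom∖ell)** `‖Θₙ(g)‖ ≤ M(g)` for a.e. `g` with NON-compact centraliser, all `n`, with `M ∈ L¹_loc(μ)`,

THEN `∃ Θ ∈ L¹_loc(μ)` with `χ_c(f) = ∫ f Θ dμ` for EVERY test function `f` (global form), hence the row-11 shape «charLocIntNear s» at EVERY `s ∈ G_Λ`.  The elliptic
half of (lim)/(dom) is DISCHARGED here by ★ B3 `exists_ellWeight_quotScalar` (a.e. form: no Lemma 14, no regularity).  The frame inputs of ★ p856074 that brick B2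
(`K2E3GL3ModCocompactFrame`, K2E3-p03 (g4)) delivers — `[NonarchimedeanGroup G_Λ]`, `hZ : IsCompact (center G_Λ)`, `[μ.IsInvInvariant]` — enter as hypotheses and are
discharged in the final B6 file; the two remaining named inputs (lim∖ell), (dom∖ell) are EXACTLY what bricks B4 (non-elliptic tori, HC Thms 18–20) + B5 (weight
`|D|^{-1/2}(1+|log|D||)^ℓ ∈ L¹_loc`) must deliver (their bytes are pinned by this file).

* §1 `exists_rep_data_of_isSupercuspidal_quotScalar` — class plumbing: a supercuspidal class of `G_Λ` has an admissible supercuspidal representative with an invariant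
  positive-definite Hermitian form (★ `isUnitarizable_of_isSupercuspidal_of_isCompact_center`, compact open `K_Λ` ★ B0a-U, compact centre).
* §2 **`exists_locallyIntegrable_smoothTrace_eq_quotScalar`** (global), **`charLocIntNear_quotScalar_of_nonell`** (row-11 shape at every `s`),
  **`charLocIntNear_quotScalar_of_exists_nonell`** (∃-packaged).

HONEST LABEL: HC_CM is proved only modulo the 7 printed citations (2 remaining named inputs: hLiu418 = stmt-HodgeConjecture-24832, h413 =
stmt-HodgeConjecture-24833) until rung 0 closes; count-neutral (kernel lane `--supports stmt-HodgeConjecture-24833 --as helper`), THEOREMS ONLY; CONDITIONAL on the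
non-elliptic estimates (lim∖ell)/(dom∖ell) (bricks B4/B5, OPEN) and on the frame facts of B2 (in flight) — it closes nothing by itself.

References: Harish-Chandra (van Dijk) 1970, Part VII Thm 16 p. 67, §3 pp. 70–73 [cite: HarishChandra1970, Part VII Thm 16 p. 67]; Rogawski 1990 §1.6 pp. 5–6, §12.2
p. 173 [cite: Rogawski1990, §12.2 p. 173]; Bernstein–Zelevinsky 1976 §2.40–2.42 [cite: BernsteinZelevinsky1976, §2.40–2.42].
-/

open MeasureTheory MeasureTheory.Measure Set Function Filter
open scoped NNReal ENNReal MatrixGroups Pointwise WithZero Valued Topology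
open Matrix
open Literature.NumberTheory.Automorphic Literature.NumberTheory.GaloisRepresentations Literature.NumberTheory.GaloisRepresentations.IsNonarchimedeanLocalField
open Summit.HodgeConjecture.HodgeConjecture.Cruxes.H413.K2E3GL3ModCentre Summit.HodgeConjecture.HodgeConjecture.Cruxes.H413.K2E3GL3ModCocompactCentral
open Summit.HodgeConjecture.HodgeConjecture.Cruxes.H413.K2E3GL3ModCocompactUnimodular Summit.HodgeConjecture.HodgeConjecture.Cruxes.H413.K2E3GL3ModCocompactEllPackage

set_option linter.dupNamespace false

noncomputable section

namespace Summit.HodgeConjecture.HodgeConjecture.Cruxes.H413.K2E3GL3ModCocompactCharLocInt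

variable {F : Type*} [Field F] [Valued F ℤᵐ⁰] [ValuativeRel F] [(Valued.v : Valuation F ℤᵐ⁰).Compatible] [IsNonarchimedeanLocalField F]
  (Λ₀ : Subgroup Fˣ) [(Λ₀.map (Matrix.GeneralLinearGroup.scalar (Fin 3))).Normal]

/-! ## §1 Class plumbing at `G_Λ` -/

omit [(Valued.v : Valuation F ℤᵐ⁰).Compatible] in
/-- **A supercuspidal class of `G_Λ` (compact centre) has an ADMISSIBLE supercuspidal representative with a `G_Λ`-invariant positive-definite Hermitian form**
(★ `IsSupercuspidal.isAdmissible_of_sigmaCompactSpace`; ★ `isUnitarizable_of_isSupercuspidal_of_isCompact_center` with the compact open `K_Λ` ★ B0a-U).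
[cite: BernsteinZelevinsky1976, §2.40–2.42] [cite: Rogawski1990, §12.2 p. 173] -/
theorem exists_rep_data_of_isSupercuspidal_quotScalar [NonarchimedeanGroup (GL (Fin 3) F ⧸ Λ₀.map (Matrix.GeneralLinearGroup.scalar (Fin 3)))]
    (hZ : IsCompact ((Subgroup.center (GL (Fin 3) F ⧸ Λ₀.map (Matrix.GeneralLinearGroup.scalar (Fin 3)))) :
      Set (GL (Fin 3) F ⧸ Λ₀.map (Matrix.GeneralLinearGroup.scalar (Fin 3)))))
    (c : IrrClass (GL (Fin 3) F ⧸ Λ₀.map (Matrix.GeneralLinearGroup.scalar (Fin 3)))) (hc : c.IsSupercuspidal) :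
    ∃ r : SmoothIrrep (GL (Fin 3) F ⧸ Λ₀.map (Matrix.GeneralLinearGroup.scalar (Fin 3))), IrrClass.mk r = c ∧ r.ρ.IsSupercuspidal ∧ r.ρ.IsAdmissible ∧
      ∃ B : r.V →ₗ⋆[ℂ] r.V →ₗ[ℂ] ℂ, B.IsSymm ∧ (∀ x : r.V, x ≠ 0 → 0 < (B x x).re) ∧
        ∀ (g : GL (Fin 3) F ⧸ Λ₀.map (Matrix.GeneralLinearGroup.scalar (Fin 3))) (x y : r.V), B (r.ρ g x) (r.ρ g y) = B x y := by
  haveI : SecondCountableTopology (GL (Fin 3) F) := secondCountableTopology_gl3 F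
  haveI : LocallyCompactSpace (GL (Fin 3) F) := locallyCompactSpace_gl3 F
  haveI : SigmaCompactSpace (GL (Fin 3) F ⧸ Λ₀.map (Matrix.GeneralLinearGroup.scalar (Fin 3))) := sigmaCompactSpace_of_locallyCompact_secondCountable
  induction c using IrrClass.ind with
  | h r =>
    rw [IrrClass.isSupercuspidal_mk] at hc
    haveI : r.ρ.IsIrreducible := r.isIrreducible
    have hadm : r.ρ.IsAdmissible := Representation.IsSupercuspidal.isAdmissible_of_sigmaCompactSpace r.isSmooth hc
    obtain ⟨B, hBsymm, hBpos, hBinv⟩ :=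
      r.ρ.isUnitarizable_of_isSupercuspidal_of_isCompact_center r.isSmooth (isOpen_kLambda Λ₀) (isCompact_kLambda Λ₀) hc hZ
    exact ⟨r, rfl, hc, hadm, B, hBsymm, hBpos, hBinv⟩

/-! ## §2 The composition: (lim∖ell) ⊕ (dom∖ell) ⇒ the character of a supercuspidal class of `G_Λ` is an `L¹_loc` function -/

variable [MeasurableSpace (GL (Fin 3) F ⧸ Λ₀.map (Matrix.GeneralLinearGroup.scalar (Fin 3)))] [BorelSpace (GL (Fin 3) F ⧸ Λ₀.map (Matrix.GeneralLinearGroup.scalar (Fin 3)))]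

open scoped Classical in
/-- **(GL-[M6]-sc, B6-core) HARISH-CHANDRA'S THEOREM 16 ON `G_Λ`, MODULO THE NON-ELLIPTIC ESTIMATES.**  `Λ ≤ F^×` closed, `F^× ⧸ Λ` compact, `μ` an inversion-invariant
Haar measure on `G_Λ` (nonarchimedean, compact centre — brick B2); `c` a class with supercuspidal representative `r`, invariant positive-definite Hermitian `B`, `v₁ ≠ 0`,
`Ω` a compact exhaustion.  IF the truncated orbital integrals of the coefficient CONVERGE (`hlim`) and are DOMINATED by `M ∈ L¹_loc` (`hdom`, `hM`) almost everywhere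
OFF the compact-centraliser set, THEN `∃ Θ ∈ L¹_loc(μ)`, `χ_c(f) = ∫ f Θ dμ` for every `f ∈ C_c^∞(G_Λ)`.  The elliptic halves of `hlim`/`hdom` are ★ B3
(`exists_ellWeight_quotScalar`: the orbital integrals are eventually constant and bounded by the `L¹_loc` weight `W_E` a.e. ON the compact-centraliser set); the
majorant is `‖M‖ + W_E`; then ★ p856074 `locallyIntegrable_of_truncatedOrbital_tendsto` ∕ `smoothTrace_eq_integral_mul_of_truncatedOrbital_tendsto`.
[cite: HarishChandra1970, Part VII Thm 16 p. 67] [cite: Rogawski1990, §12.2 p. 173] -/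
theorem exists_locallyIntegrable_smoothTrace_eq_quotScalar [CharZero F] {ϖ : F} (hϖ : Valued.v ϖ = WithZero.exp (-1 : ℤ))
    (hΛ : IsClosed (Λ₀ : Set Fˣ)) [CompactSpace (Fˣ ⧸ Λ₀)]
    [NonarchimedeanGroup (GL (Fin 3) F ⧸ Λ₀.map (Matrix.GeneralLinearGroup.scalar (Fin 3)))]
    (μ : Measure (GL (Fin 3) F ⧸ Λ₀.map (Matrix.GeneralLinearGroup.scalar (Fin 3)))) [μ.IsHaarMeasure] [μ.IsInvInvariant]
    (hZ : IsCompact ((Subgroup.center (GL (Fin 3) F ⧸ Λ₀.map (Matrix.GeneralLinearGroup.scalar (Fin 3)))) :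
      Set (GL (Fin 3) F ⧸ Λ₀.map (Matrix.GeneralLinearGroup.scalar (Fin 3)))))
    (c : IrrClass (GL (Fin 3) F ⧸ Λ₀.map (Matrix.GeneralLinearGroup.scalar (Fin 3))))
    (r : SmoothIrrep (GL (Fin 3) F ⧸ Λ₀.map (Matrix.GeneralLinearGroup.scalar (Fin 3)))) (hr : IrrClass.mk r = c) (hsc : r.ρ.IsSupercuspidal)
    (B : r.V →ₗ⋆[ℂ] r.V →ₗ[ℂ] ℂ) (hBsymm : B.IsSymm) (hBpos : ∀ x : r.V, x ≠ 0 → 0 < (B x x).re)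
    (hBinv : ∀ (g : GL (Fin 3) F ⧸ Λ₀.map (Matrix.GeneralLinearGroup.scalar (Fin 3))) (x y : r.V), B (r.ρ g x) (r.ρ g y) = B x y)
    (v₁ : r.V) (hv₁ : v₁ ≠ 0)
    (Ω : CompactExhaustion (GL (Fin 3) F ⧸ Λ₀.map (Matrix.GeneralLinearGroup.scalar (Fin 3))))
    (Fl : (GL (Fin 3) F ⧸ Λ₀.map (Matrix.GeneralLinearGroup.scalar (Fin 3))) → ℂ) (M : (GL (Fin 3) F ⧸ Λ₀.map (Matrix.GeneralLinearGroup.scalar (Fin 3))) → ℝ)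
    (hlim : ∀ᵐ g ∂μ, ¬ IsCompact ((Subgroup.centralizer ({g} : Set (GL (Fin 3) F ⧸ Λ₀.map (Matrix.GeneralLinearGroup.scalar (Fin 3))))) :
        Set (GL (Fin 3) F ⧸ Λ₀.map (Matrix.GeneralLinearGroup.scalar (Fin 3)))) →
      Tendsto (fun n => ∫ x in Ω n, B v₁ (r.ρ (x * g * x⁻¹) v₁) ∂μ) atTop (𝓝 (Fl g)))
    (hdom : ∀ n, ∀ᵐ g ∂μ, ¬ IsCompact ((Subgroup.centralizer ({g} : Set (GL (Fin 3) F ⧸ Λ₀.map (Matrix.GeneralLinearGroup.scalar (Fin 3))))) :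
        Set (GL (Fin 3) F ⧸ Λ₀.map (Matrix.GeneralLinearGroup.scalar (Fin 3)))) →
      ‖∫ x in Ω n, B v₁ (r.ρ (x * g * x⁻¹) v₁) ∂μ‖ ≤ M g)
    (hM : LocallyIntegrable M μ) :
    ∃ Θ : (GL (Fin 3) F ⧸ Λ₀.map (Matrix.GeneralLinearGroup.scalar (Fin 3))) → ℂ, LocallyIntegrable Θ μ ∧
      ∀ f : (GL (Fin 3) F ⧸ Λ₀.map (Matrix.GeneralLinearGroup.scalar (Fin 3))) → ℂ,
        f ∈ SchwartzBruhat (GL (Fin 3) F ⧸ Λ₀.map (Matrix.GeneralLinearGroup.scalar (Fin 3))) → c.smoothTrace μ f = ∫ g, f g * Θ g ∂μ := by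
  subst hr
  -- §0 frame
  haveI : SecondCountableTopology (GL (Fin 3) F) := secondCountableTopology_gl3 F
  haveI : LocallyCompactSpace (GL (Fin 3) F) := locallyCompactSpace_gl3 F
  haveI : T2Space (GL (Fin 3) F ⧸ Λ₀.map (Matrix.GeneralLinearGroup.scalar (Fin 3))) := t2Space_quotScalar Λ₀ hΛ
  haveI : SigmaCompactSpace (GL (Fin 3) F ⧸ Λ₀.map (Matrix.GeneralLinearGroup.scalar (Fin 3))) := sigmaCompactSpace_of_locallyCompact_secondCountable
  haveI : r.ρ.IsIrreducible := r.isIrreducible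
  have hadm : r.ρ.IsAdmissible := Representation.IsSupercuspidal.isAdmissible_of_sigmaCompactSpace r.isSmooth hsc
  have hΩm : ∀ n, MeasurableSet (Ω n) := fun n => (Ω.isCompact n).isClosed.measurableSet
  have hΩc : ∀ n, IsCompact (Ω n) := fun n => Ω.isCompact n
  have hΩmono : Monotone Ω := fun m n hmn => Ω.subset hmn
  have hΩcov : ∀ x, ∃ n, x ∈ Ω n := fun x => Ω.exists_mem x
  -- §1 the coefficient and its elliptic package ★ B3
  have hθc : Continuous fun y : GL (Fin 3) F ⧸ Λ₀.map (Matrix.GeneralLinearGroup.scalar (Fin 3)) => B v₁ (r.ρ y v₁) :=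
    Representation.continuous_sesqForm_apply_apply (r.isSmooth v₁) v₁
  have hθs : HasCompactSupport fun y : GL (Fin 3) F ⧸ Λ₀.map (Matrix.GeneralLinearGroup.scalar (Fin 3)) => B v₁ (r.ρ y v₁) :=
    hsc.hasCompactSupport_sesqForm_apply_apply hZ r.isSmooth hBinv v₁ v₁
  obtain ⟨W, hWloc, hW0, hae⟩ := exists_ellWeight_quotScalar hϖ Λ₀ hΛ μ hθc hθs Ω
  -- §2 the limit redefined on the compact-centraliser set; the majorant `‖M‖ + W`
  set F' : (GL (Fin 3) F ⧸ Λ₀.map (Matrix.GeneralLinearGroup.scalar (Fin 3))) → ℂ := fun g =>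
    if IsCompact ((Subgroup.centralizer ({g} : Set (GL (Fin 3) F ⧸ Λ₀.map (Matrix.GeneralLinearGroup.scalar (Fin 3))))) :
        Set (GL (Fin 3) F ⧸ Λ₀.map (Matrix.GeneralLinearGroup.scalar (Fin 3))))
      then ∫ x, B v₁ (r.ρ (x * g * x⁻¹) v₁) ∂μ else Fl g with hF'
  have hlim' : ∀ᵐ g ∂μ, Tendsto (fun n => ∫ x in Ω n, B v₁ (r.ρ (x * g * x⁻¹) v₁) ∂μ) atTop (𝓝 (F' g)) := by
    filter_upwards [hlim, hae] with g hg hge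
    by_cases hE : IsCompact ((Subgroup.centralizer ({g} : Set (GL (Fin 3) F ⧸ Λ₀.map (Matrix.GeneralLinearGroup.scalar (Fin 3))))) :
        Set (GL (Fin 3) F ⧸ Λ₀.map (Matrix.GeneralLinearGroup.scalar (Fin 3))))
    · obtain ⟨-, R, -, -, hT, hfull, -⟩ := hge hE
      have hval : F' g = ∫ x, B v₁ (r.ρ (x * g * x⁻¹) v₁) ∂μ := by rw [hF']; exact if_pos hE
      rw [hval, ← hfull]
      exact hT
    · have hval : F' g = Fl g := by rw [hF']; exact if_neg hE
      rw [hval]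
      exact hg hE
  have hdom' : ∀ n, ∀ᵐ g ∂μ, ‖∫ x in Ω n, B v₁ (r.ρ (x * g * x⁻¹) v₁) ∂μ‖ ≤ ‖M g‖ + W g := by
    intro n
    filter_upwards [hdom n, hae] with g hg hge
    by_cases hE : IsCompact ((Subgroup.centralizer ({g} : Set (GL (Fin 3) F ⧸ Λ₀.map (Matrix.GeneralLinearGroup.scalar (Fin 3))))) :
        Set (GL (Fin 3) F ⧸ Λ₀.map (Matrix.GeneralLinearGroup.scalar (Fin 3))))
    · obtain ⟨-, R, -, hloc, -, -, hball⟩ := hge hE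
      have hint : IntegrableOn (fun x : GL (Fin 3) F ⧸ Λ₀.map (Matrix.GeneralLinearGroup.scalar (Fin 3)) => ‖B v₁ (r.ρ (x * g * x⁻¹) v₁)‖) (Ω R) μ :=
        ((hθc.comp ((continuous_id.mul continuous_const).mul continuous_id.inv)).norm.continuousOn).integrableOn_compact (Ω.isCompact R)
      calc ‖∫ x in Ω n, B v₁ (r.ρ (x * g * x⁻¹) v₁) ∂μ‖ = ‖∫ x in Ω n ∩ Ω R, B v₁ (r.ρ (x * g * x⁻¹) v₁) ∂μ‖ := by rw [hloc n]
        _ ≤ ∫ x in Ω n ∩ Ω R, ‖B v₁ (r.ρ (x * g * x⁻¹) v₁)‖ ∂μ := norm_integral_le_integral_norm _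
        _ ≤ ∫ x in Ω R, ‖B v₁ (r.ρ (x * g * x⁻¹) v₁)‖ ∂μ :=
          setIntegral_mono_set hint (Eventually.of_forall fun _ => norm_nonneg _) (Eventually.of_forall Set.inter_subset_right)
        _ ≤ W g := hball
        _ ≤ ‖M g‖ + W g := le_add_of_nonneg_left (norm_nonneg _)
    · exact (hg hE).trans ((Real.le_norm_self _).trans (le_add_of_nonneg_right (hW0 g)))
  have hM' : LocallyIntegrable (fun g => ‖M g‖ + W g) μ := by
    rw [locallyIntegrable_iff] at hM hWloc ⊢
    exact fun K hK => (hM K hK).norm.add (hWloc K hK)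
  -- §3 ★ p856074
  have hF'loc : LocallyIntegrable F' μ :=
    K2E3SupercuspidalCharacterDominatedLimit.locallyIntegrable_of_truncatedOrbital_tendsto (B := B) r.isSmooth μ v₁ Ω hΩm hlim' hdom' hM'
  have hΘloc : LocallyIntegrable (fun g => ((((∫ x, ‖B (r.ρ x v₁) v₁‖ ^ 2 ∂μ) / (B v₁ v₁).re ^ 2 : ℝ) : ℂ) * B v₁ v₁)⁻¹ * F' g) μ := by
    have h := hF'loc.smul ((((∫ x, ‖B (r.ρ x v₁) v₁‖ ^ 2 ∂μ) / (B v₁ v₁).re ^ 2 : ℝ) : ℂ) * B v₁ v₁)⁻¹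
    simpa only [Pi.smul_def, smul_eq_mul] using h
  refine ⟨fun g => ((((∫ x, ‖B (r.ρ x v₁) v₁‖ ^ 2 ∂μ) / (B v₁ v₁).re ^ 2 : ℝ) : ℂ) * B v₁ v₁)⁻¹ * F' g, hΘloc, fun f hf => ?_⟩
  rw [IrrClass.smoothTrace_mk]
  exact K2E3SupercuspidalCharacterDominatedLimit.smoothTrace_eq_integral_mul_of_truncatedOrbital_tendsto hadm hsc hZ hBsymm hBpos hBinv μ hv₁ hv₁
    Ω hΩm hΩc hΩmono hΩcov hlim' hdom' hM' hf

/-- **B6-core in the ROW-11 SHAPE at every `s ∈ G_Λ`**: under the hypotheses of `exists_locallyIntegrable_smoothTrace_eq_quotScalar`, for every `s` there is an open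
`U ∋ s`, `Θ` integrable on `U`, with `χ_c(f) = ∫ f Θ dμ` for every test function supported in `U` (`U` = interior of a compact neighbourhood, `Θ` the global
`L¹_loc` density). [cite: HarishChandra1970, Part VII Thm 16 p. 67] [cite: HarishChandra1999, Thm. 16.1 p. 77] -/
theorem charLocIntNear_quotScalar_of_nonell [CharZero F] {ϖ : F} (hϖ : Valued.v ϖ = WithZero.exp (-1 : ℤ))
    (hΛ : IsClosed (Λ₀ : Set Fˣ)) [CompactSpace (Fˣ ⧸ Λ₀)]
    [NonarchimedeanGroup (GL (Fin 3) F ⧸ Λ₀.map (Matrix.GeneralLinearGroup.scalar (Fin 3)))]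
    (μ : Measure (GL (Fin 3) F ⧸ Λ₀.map (Matrix.GeneralLinearGroup.scalar (Fin 3)))) [μ.IsHaarMeasure] [μ.IsInvInvariant]
    (hZ : IsCompact ((Subgroup.center (GL (Fin 3) F ⧸ Λ₀.map (Matrix.GeneralLinearGroup.scalar (Fin 3)))) :
      Set (GL (Fin 3) F ⧸ Λ₀.map (Matrix.GeneralLinearGroup.scalar (Fin 3)))))
    (c : IrrClass (GL (Fin 3) F ⧸ Λ₀.map (Matrix.GeneralLinearGroup.scalar (Fin 3))))
    (r : SmoothIrrep (GL (Fin 3) F ⧸ Λ₀.map (Matrix.GeneralLinearGroup.scalar (Fin 3)))) (hr : IrrClass.mk r = c) (hsc : r.ρ.IsSupercuspidal)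
    (B : r.V →ₗ⋆[ℂ] r.V →ₗ[ℂ] ℂ) (hBsymm : B.IsSymm) (hBpos : ∀ x : r.V, x ≠ 0 → 0 < (B x x).re)
    (hBinv : ∀ (g : GL (Fin 3) F ⧸ Λ₀.map (Matrix.GeneralLinearGroup.scalar (Fin 3))) (x y : r.V), B (r.ρ g x) (r.ρ g y) = B x y)
    (v₁ : r.V) (hv₁ : v₁ ≠ 0)
    (Ω : CompactExhaustion (GL (Fin 3) F ⧸ Λ₀.map (Matrix.GeneralLinearGroup.scalar (Fin 3))))
    (Fl : (GL (Fin 3) F ⧸ Λ₀.map (Matrix.GeneralLinearGroup.scalar (Fin 3))) → ℂ) (M : (GL (Fin 3) F ⧸ Λ₀.map (Matrix.GeneralLinearGroup.scalar (Fin 3))) → ℝ)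
    (hlim : ∀ᵐ g ∂μ, ¬ IsCompact ((Subgroup.centralizer ({g} : Set (GL (Fin 3) F ⧸ Λ₀.map (Matrix.GeneralLinearGroup.scalar (Fin 3))))) :
        Set (GL (Fin 3) F ⧸ Λ₀.map (Matrix.GeneralLinearGroup.scalar (Fin 3)))) →
      Tendsto (fun n => ∫ x in Ω n, B v₁ (r.ρ (x * g * x⁻¹) v₁) ∂μ) atTop (𝓝 (Fl g)))
    (hdom : ∀ n, ∀ᵐ g ∂μ, ¬ IsCompact ((Subgroup.centralizer ({g} : Set (GL (Fin 3) F ⧸ Λ₀.map (Matrix.GeneralLinearGroup.scalar (Fin 3))))) :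
        Set (GL (Fin 3) F ⧸ Λ₀.map (Matrix.GeneralLinearGroup.scalar (Fin 3)))) →
      ‖∫ x in Ω n, B v₁ (r.ρ (x * g * x⁻¹) v₁) ∂μ‖ ≤ M g)
    (hM : LocallyIntegrable M μ) :
    ∀ s : GL (Fin 3) F ⧸ Λ₀.map (Matrix.GeneralLinearGroup.scalar (Fin 3)),
      ∃ U : Set (GL (Fin 3) F ⧸ Λ₀.map (Matrix.GeneralLinearGroup.scalar (Fin 3))), IsOpen U ∧ s ∈ U ∧
        ∃ Θ : (GL (Fin 3) F ⧸ Λ₀.map (Matrix.GeneralLinearGroup.scalar (Fin 3))) → ℂ, IntegrableOn Θ U μ ∧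
          ∀ f : (GL (Fin 3) F ⧸ Λ₀.map (Matrix.GeneralLinearGroup.scalar (Fin 3))) → ℂ,
            f ∈ SchwartzBruhat (GL (Fin 3) F ⧸ Λ₀.map (Matrix.GeneralLinearGroup.scalar (Fin 3))) → tsupport f ⊆ U →
              c.smoothTrace μ f = ∫ g, f g * Θ g ∂μ := by
  haveI : SecondCountableTopology (GL (Fin 3) F) := secondCountableTopology_gl3 F
  haveI : LocallyCompactSpace (GL (Fin 3) F) := locallyCompactSpace_gl3 F
  intro s
  obtain ⟨Θ, hΘ, htr⟩ := exists_locallyIntegrable_smoothTrace_eq_quotScalar Λ₀ hϖ hΛ μ hZ c r hr hsc B hBsymm hBpos hBinv v₁ hv₁ Ω Fl M hlim hdom hM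
  obtain ⟨K, hK, hKs⟩ := exists_compact_mem_nhds s
  exact ⟨interior K, isOpen_interior, mem_interior_iff_mem_nhds.2 hKs, Θ, (hΘ.integrableOn_isCompact hK).mono_set interior_subset, fun f hf _ => htr f hf⟩

/-- **B6-core, ∃-packaged: «row 11 at `G_Λ` for a supercuspidal class ⟸ the NON-ELLIPTIC estimates for SOME datum»** — for `c` supercuspidal, if for SOME
representative `r`, SOME invariant positive-definite Hermitian `B`, SOME `v₁ ≠ 0`, SOME compact exhaustion `Ω` the truncated orbital integrals of `y ↦ B v₁ (r(y) v₁)`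
satisfy (lim∖ell) and (dom∖ell) with an `L¹_loc` majorant, then «charLocIntNear s» holds at every `s ∈ G_Λ`.  With §1 a brick proving the two estimates «for every
unitarizable supercuspidal datum along its own exhaustion» (B4 + B5) feeds this in one line. [cite: HarishChandra1970, Part VII Thm 16 p. 67, §3 pp. 70–73] -/
theorem charLocIntNear_quotScalar_of_exists_nonell [CharZero F] {ϖ : F} (hϖ : Valued.v ϖ = WithZero.exp (-1 : ℤ))
    (hΛ : IsClosed (Λ₀ : Set Fˣ)) [CompactSpace (Fˣ ⧸ Λ₀)]
    [NonarchimedeanGroup (GL (Fin 3) F ⧸ Λ₀.map (Matrix.GeneralLinearGroup.scalar (Fin 3)))]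
    (μ : Measure (GL (Fin 3) F ⧸ Λ₀.map (Matrix.GeneralLinearGroup.scalar (Fin 3)))) [μ.IsHaarMeasure] [μ.IsInvInvariant]
    (hZ : IsCompact ((Subgroup.center (GL (Fin 3) F ⧸ Λ₀.map (Matrix.GeneralLinearGroup.scalar (Fin 3)))) :
      Set (GL (Fin 3) F ⧸ Λ₀.map (Matrix.GeneralLinearGroup.scalar (Fin 3)))))
    (c : IrrClass (GL (Fin 3) F ⧸ Λ₀.map (Matrix.GeneralLinearGroup.scalar (Fin 3))))
    (hNE : ∃ r : SmoothIrrep (GL (Fin 3) F ⧸ Λ₀.map (Matrix.GeneralLinearGroup.scalar (Fin 3))), IrrClass.mk r = c ∧ r.ρ.IsSupercuspidal ∧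
      ∃ B : r.V →ₗ⋆[ℂ] r.V →ₗ[ℂ] ℂ, B.IsSymm ∧ (∀ x : r.V, x ≠ 0 → 0 < (B x x).re) ∧
        (∀ (g : GL (Fin 3) F ⧸ Λ₀.map (Matrix.GeneralLinearGroup.scalar (Fin 3))) (x y : r.V), B (r.ρ g x) (r.ρ g y) = B x y) ∧
        ∃ v₁ : r.V, v₁ ≠ 0 ∧
          ∃ (Ω : CompactExhaustion (GL (Fin 3) F ⧸ Λ₀.map (Matrix.GeneralLinearGroup.scalar (Fin 3))))
            (Fl : (GL (Fin 3) F ⧸ Λ₀.map (Matrix.GeneralLinearGroup.scalar (Fin 3))) → ℂ)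
            (M : (GL (Fin 3) F ⧸ Λ₀.map (Matrix.GeneralLinearGroup.scalar (Fin 3))) → ℝ),
            (∀ᵐ g ∂μ, ¬ IsCompact ((Subgroup.centralizer ({g} : Set (GL (Fin 3) F ⧸ Λ₀.map (Matrix.GeneralLinearGroup.scalar (Fin 3))))) :
                Set (GL (Fin 3) F ⧸ Λ₀.map (Matrix.GeneralLinearGroup.scalar (Fin 3)))) →
              Tendsto (fun n => ∫ x in Ω n, B v₁ (r.ρ (x * g * x⁻¹) v₁) ∂μ) atTop (𝓝 (Fl g))) ∧
            (∀ n, ∀ᵐ g ∂μ, ¬ IsCompact ((Subgroup.centralizer ({g} : Set (GL (Fin 3) F ⧸ Λ₀.map (Matrix.GeneralLinearGroup.scalar (Fin 3))))) :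
                Set (GL (Fin 3) F ⧸ Λ₀.map (Matrix.GeneralLinearGroup.scalar (Fin 3)))) →
              ‖∫ x in Ω n, B v₁ (r.ρ (x * g * x⁻¹) v₁) ∂μ‖ ≤ M g) ∧
            LocallyIntegrable M μ) :
    ∀ s : GL (Fin 3) F ⧸ Λ₀.map (Matrix.GeneralLinearGroup.scalar (Fin 3)),
      ∃ U : Set (GL (Fin 3) F ⧸ Λ₀.map (Matrix.GeneralLinearGroup.scalar (Fin 3))), IsOpen U ∧ s ∈ U ∧
        ∃ Θ : (GL (Fin 3) F ⧸ Λ₀.map (Matrix.GeneralLinearGroup.scalar (Fin 3))) → ℂ, IntegrableOn Θ U μ ∧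
          ∀ f : (GL (Fin 3) F ⧸ Λ₀.map (Matrix.GeneralLinearGroup.scalar (Fin 3))) → ℂ,
            f ∈ SchwartzBruhat (GL (Fin 3) F ⧸ Λ₀.map (Matrix.GeneralLinearGroup.scalar (Fin 3))) → tsupport f ⊆ U →
              c.smoothTrace μ f = ∫ g, f g * Θ g ∂μ := by
  obtain ⟨r, hr, hsc, B, hBsymm, hBpos, hBinv, v₁, hv₁, Ω, Fl, M, hlim, hdom, hM⟩ := hNE
  exact charLocIntNear_quotScalar_of_nonell Λ₀ hϖ hΛ μ hZ c r hr hsc B hBsymm hBpos hBinv v₁ hv₁ Ω Fl M hlim hdom hM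

end Summit.HodgeConjecture.HodgeConjecture.Cruxes.H413.K2E3GL3ModCocompactCharLocInt

end
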